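import Summits.CriticalPhenomena.PercolationContinuityZ3.Theorems.PercNearOneGluingNoHeavyLowerTailQ7PsiMaxRobust
import Summits.CriticalPhenomena.PercolationContinuityZ3.Theorems.PercNearOneGluingNoHeavyLowerTailQ7ThreeRobust
import HarnessLib

/-!
# `NoHeavyLowerTail` (stmt-CriticalPhenomena-4575) — the MAX-ROBUST form of Kozma–Nitzan's Question 7 at three relays
# (vertex observer): ONE deficit — to the minimum reliability — instead of the sum of two

Support file (`--supports stmt-CriticalPhenomena-4575`, closed), coupling seat `prim-cplus-coupling` (gen 14/15).  No
definitions, no named facts, no sorries; standard axioms.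

`…Q7ThreeRobust.lean` (gen 11) proved the stability form of Question 7 with the SUM of the two reliability deficits
`(μ(z↔b) − μ(x↔b))⁺ + (μ(z↔b) − μ(y↔b))⁺` as slack.  `…Q7PsiMaxRobust.lean` (gen 14) showed that the closed-form dual
multipliers of (GΨ₃) satisfy `λ* + μ* ≤ 1`, whence the set-observer (GΨ₃) holds with `min(Dx, Dy, 0)` on the left.  This
file specialises to a vertex observer and runs the gen-9/gen-11 assembly (peeling `Q7Psi.q7_of_psi_robust`, green bridge
`Q7Psi.real_inter_openConn_eq_integral_green`, (GΨ₃) on `G ∖ b`) with it: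

* `Q7Psi.gpsi_three_maxrobust` — EVERY weight vector, distinct `x, y, z`, any `o`, any monotone `F`:
  `min(E F(C x) − E F(C z), E F(C y) − E F(C z), 0) ≤ ∫_J F(C o) − ∫_J F(C z)`, `J = {o↔x} ∪ {o↔y}`;
* `Q7Psi.q7_three_maxrobust` — **Question 7 for three relays, max-robust form**: `o, x, y, z ≠ b`, `x, y, z` distinct,
  NO reliability hypothesis, `A = {x, y, z}`:
  `μ({z↔b} ∩ {o↔A}) − μ({o↔b} ∩ {o↔A}) ≤ max(μ(z↔b) − μ(x↔b), μ(z↔b) − μ(y↔b), 0) = (μ(z↔b) − min(μ(x↔b), μ(y↔b)))⁺`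
  (prim-lf-3's "max-robust Q7", LF3-BETA-R §18: `μ(ob, oA) + μ(vb) − μ(vb, oA) ≥ min_{a∈A} μ(ab)` for every `v ∈ A`);
* `Q7Psi.q7_three_maxslack` — ONE `δ`: `μ(z↔b) ≤ μ(x↔b) + δ`, `μ(z↔b) ≤ μ(y↔b) + δ` imply
  `μ({z↔b} ∩ {o↔A}) ≤ μ({o↔b} ∩ {o↔A}) + δ` (the sum form gave `2δ`); `q7_three_maxrobust_finset`.
[cite: KozmaNitzan2024, Question 7 and Question 9 (p. 36), Conjectures 1–2 (p. 3), Lemma 5 (pp. 13–14), §5.1 (pp. 31–32)]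
[cite: VandenbergHaggstromKahn2005, Thms. 1.3–1.5 (pp. 6–8)]
-/

namespace Summit.CriticalPhenomena.PercolationContinuityZ3.Theorems

open MeasureTheory Set Literature.Probability.LatticeModels Literature.Probability.Percolation
open scoped Classical
open KNPreFKG BHK2006

noncomputable section

namespace Q7Psi

universe u

variable {V : Type u} [Fintype V]

/-- **Max-robust (GΨ₃), vertex observer, EVERY weight vector.**  For distinct relays `x, y, z`, every observer `o` and
every monotone real cluster property `F`:
`min(E F(C x) − E F(C z), E F(C y) − E F(C z), 0) ≤ ∫_{o↔x ∪ o↔y} F(C o) − ∫_{o↔x ∪ o↔y} F(C z)`.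
(`gpsi_three_set_maxrobust` at the observer set `N = {o}`.)
[cite: KozmaNitzan2024, §5.1 (pp. 31–32), Question 7 (p. 36)] -/
theorem gpsi_three_maxrobust (w : Sym2 V → unitInterval) (o x y z : V) (hxy : x ≠ y) (hxz : x ≠ z) (hyz : y ≠ z)
    (F : Set V → ℝ) (hF : ∀ S T : Set V, S ⊆ T → F S ≤ F T) :
    min (min ((∫ ω, F (openCluster ω x) ∂(prodBernoulli w)) - ∫ ω, F (openCluster ω z) ∂(prodBernoulli w))
        ((∫ ω, F (openCluster ω y) ∂(prodBernoulli w)) - ∫ ω, F (openCluster ω z) ∂(prodBernoulli w))) 0 ≤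
      (∫ ω in (openConn o x ∪ openConn o y), F (openCluster ω o) ∂(prodBernoulli w)) -
        ∫ ω in (openConn o x ∪ openConn o y), F (openCluster ω z) ∂(prodBernoulli w) := by
  have key := gpsi_three_set_maxrobust w x y z ({o} : Set V) hxy hxz hyz F hF
  have hS : ∀ v : V, {ω : BondConfig V | ∃ n ∈ ({o} : Set V), (openGraph ω).Reachable v n} = openConn o v := by
    intro v; ext ω
    simp only [mem_setOf_eq, mem_singleton_iff, exists_eq_left, openConn]
    exact SimpleGraph.reachable_comm
  have hU : ∀ ω : BondConfig V, (⋃ n ∈ ({o} : Set V), openCluster ω n) = openCluster ω o :=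
    fun ω => biUnion_singleton o (openCluster ω)
  rw [hS x, hS y] at key
  simp only [hU] at key
  exact key

/-- **Kozma–Nitzan's Question 7 for three relays — MAX-ROBUST FORM (no reliability hypothesis, one deficit).**  In a finite
weighted graph let `o, x, y, z ≠ b` and `x, y, z` distinct, `A = {x, y, z}`.  Then
`μ({z↔b} ∩ {o↔A}) − μ({o↔b} ∩ {o↔A}) ≤ max(μ(z↔b) − μ(x↔b), μ(z↔b) − μ(y↔b), 0)`, written with `min`:
`min(μ(x↔b) − μ(z↔b), μ(y↔b) − μ(z↔b), 0) ≤ μ({o↔b} ∩ {o↔A}) − μ({z↔b} ∩ {o↔A})`.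
At `μ(z↔b) ≤ μ(x↔b), μ(y↔b)` this is `q7_three`; it sharpens `q7_three_robust` (sum of the two deficits).  Proof:
`q7_of_psi_robust`, the `z`-part of the peeled event contributes equally, the green bridge to `G ∖ b`, and
`gpsi_three_maxrobust` there.
[cite: KozmaNitzan2024, Question 7 (p. 36), Conjectures 1–2 (p. 3), Lemma 5 (pp. 13–14), §5.1 (pp. 31–32)] -/
theorem q7_three_maxrobust (w : Sym2 V → unitInterval) (o b x y z : V) (hob : o ≠ b) (hxb : x ≠ b) (hyb : y ≠ b)
    (hzb : z ≠ b) (hxy : x ≠ y) (hxz : x ≠ z) (hyz : y ≠ z) :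
    min (min ((prodBernoulli w).real (openConn x b) - (prodBernoulli w).real (openConn z b))
        ((prodBernoulli w).real (openConn y b) - (prodBernoulli w).real (openConn z b))) 0 ≤
      (prodBernoulli w).real (openConn o b ∩ (openConn o x ∪ openConn o y ∪ openConn o z)) -
        (prodBernoulli w).real (openConn z b ∩ (openConn o x ∪ openConn o y ∪ openConn o z)) := by
  set μ := prodBernoulli w with hμ
  have hmeas : ∀ T : Set (BondConfig V), MeasurableSet T := fun _ => MeasurableSet.of_discrete
  -- (1) reduction to the peeled form
  have hA : ∀ X : Set (BondConfig V), X ∩ (⋃ a ∈ ({x, y, z} : Finset V), (openConn o a : Set (BondConfig V))) =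
      X ∩ (openConn o x ∪ openConn o y ∪ openConn o z) := by
    intro X; congr 1; ext ω; simp [or_assoc]
  have hred := q7_of_psi_robust w o b z ({x, y, z} : Finset V)
  rw [hA, hA] at hred
  set Jx : Set (BondConfig V) := openConnIn ({b}ᶜ : Set V) o x with hJx
  set Jy : Set (BondConfig V) := openConnIn ({b}ᶜ : Set V) o y with hJy
  set Jz : Set (BondConfig V) := openConnIn ({b}ᶜ : Set V) o z with hJz
  have hJ : ∀ X : Set (BondConfig V), X ∩ (⋃ a ∈ ({x, y, z} : Finset V), openConnIn ({b}ᶜ : Set V) o a) =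
      X ∩ ((Jx ∪ Jy) ∪ Jz) := by
    intro X; congr 1; ext ω; simp [hJx, hJy, hJz, or_assoc]
  rw [hJ, hJ] at hred
  -- (2) the `z`-part of the peeled event contributes equally to both sides
  have msplit : ∀ X : Set (BondConfig V), μ.real (X ∩ ((Jx ∪ Jy) ∪ Jz)) =
      μ.real (X ∩ (Jx ∪ Jy)) + μ.real (X ∩ Jz ∩ (Jx ∪ Jy)ᶜ) := by
    intro X
    have hdj : Disjoint (X ∩ (Jx ∪ Jy)) (X ∩ Jz ∩ (Jx ∪ Jy)ᶜ) := by
      rw [Set.disjoint_left]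
      rintro ω ⟨-, h⟩ ⟨-, hn⟩
      exact hn h
    rw [← measureReal_union hdj (hmeas _)]
    congr 1
    ext ω
    simp only [mem_inter_iff, mem_union, mem_compl_iff]
    tauto
  have hz_eq : openConn z b ∩ Jz ∩ (Jx ∪ Jy)ᶜ = openConn o b ∩ Jz ∩ (Jx ∪ Jy)ᶜ := by
    ext ω
    simp only [mem_inter_iff]
    constructor
    · rintro ⟨⟨hzb', hJ⟩, hn⟩
      exact ⟨⟨(reachable_of_openConnIn hJ).trans hzb', hJ⟩, hn⟩
    · rintro ⟨⟨hob', hJ⟩, hn⟩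
      exact ⟨⟨(reachable_of_openConnIn hJ).symm.trans hob', hJ⟩, hn⟩
  rw [msplit, msplit, hz_eq] at hred
  suffices key : min (min (μ.real (openConn x b) - μ.real (openConn z b))
        (μ.real (openConn y b) - μ.real (openConn z b))) 0 ≤
      μ.real (openConn o b ∩ (Jx ∪ Jy)) - μ.real (openConn z b ∩ (Jx ∪ Jy)) by linarith
  -- (3) pass to `G ∖ b`
  set S : Set V := {b}ᶜ with hS
  haveI : Fintype S := Fintype.ofFinite S
  set r := restrictConfig (Subtype.val : S → V) with hr
  set w' : Sym2 S → unitInterval := w ∘ Sym2.map (Subtype.val : S → V) with hw'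
  set μ' := prodBernoulli w' with hμ'
  set o' : S := ⟨o, mem_compl_singleton_iff.2 hob⟩ with ho'
  set x' : S := ⟨x, mem_compl_singleton_iff.2 hxb⟩ with hx'
  set y' : S := ⟨y, mem_compl_singleton_iff.2 hyb⟩ with hy'
  set z' : S := ⟨z, mem_compl_singleton_iff.2 hzb⟩ with hz'
  set E : Set (BondConfig S) := openConn o' x' ∪ openConn o' y' with hE
  have hJE : Jx ∪ Jy = r ⁻¹' E := by
    rw [hE, preimage_union, hr, preimage_openConn_val, preimage_openConn_val]
  -- the green function
  set F : Set S → ℝ := fun T => μ.real {ω₁ : BondConfig V | ∃ s ∈ Subtype.val '' T, s ≠ b ∧ s(b, s) ∈ ω₁} with hF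
  have hFmono : ∀ T T' : Set S, T ⊆ T' → F T ≤ F T' := by
    intro T T' hTT'
    refine measureReal_mono fun ω₁ hω₁ => ?_
    obtain ⟨s, hs, hsb, hso⟩ := hω₁
    exact ⟨s, image_mono hTT' hs, hsb, hso⟩
  have hbridge : ∀ (v : V) (hvb : v ≠ b) (E₁ : Set (BondConfig S)),
      μ.real (openConn v b ∩ r ⁻¹' E₁) = ∫ ω' in E₁, F (openCluster ω' ⟨v, mem_compl_singleton_iff.2 hvb⟩) ∂μ' := by
    intro v hvb E₁
    rw [inter_comm, hr, real_inter_openConn_eq_integral_green w b v hvb E₁, ← integral_indicator (hmeas _),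
      hμ', hw', ← integral_indicator (MeasurableSet.of_discrete), ← integral_comp_restrictConfig_val]
    refine integral_congr_ae (Filter.Eventually.of_forall fun ω => ?_)
    change (restrictConfig Subtype.val ⁻¹' E₁).indicator _ ω = E₁.indicator _ (restrictConfig Subtype.val ω)
    have hfun : (fun ω : BondConfig V => μ.real {ω₁ : BondConfig V | ∃ s ∈ {y | ω ∈ openConnIn ({b}ᶜ : Set V) v y},
        s ≠ b ∧ s(b, s) ∈ ω₁}) =
        (fun ω' => F (openCluster ω' ⟨v, mem_compl_singleton_iff.2 hvb⟩)) ∘ restrictConfig (Subtype.val : S → V) := by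
      funext ω
      simp only [Function.comp_apply, hF]
      rw [setOf_openConnIn_eq_image b ω ⟨v, mem_compl_singleton_iff.2 hvb⟩]
    rw [hfun]
    exact indicator_comp_right _
  -- the reliabilities through the bridge (`E₁ = univ`)
  have htau : ∀ (v : V) (hvb : v ≠ b), μ.real (openConn v b) =
      ∫ ω', F (openCluster ω' ⟨v, mem_compl_singleton_iff.2 hvb⟩) ∂μ' := by
    intro v hvb
    rw [← setIntegral_univ, ← hbridge v hvb univ, preimage_univ, inter_univ]
  have hxy' : x' ≠ y' := fun h => hxy (congrArg Subtype.val h)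
  have hxz' : x' ≠ z' := fun h => hxz (congrArg Subtype.val h)
  have hyz' : y' ≠ z' := fun h => hyz (congrArg Subtype.val h)
  rw [hJE, hbridge z hzb E, hbridge o hob E, htau x hxb, htau y hyb, htau z hzb]
  exact gpsi_three_maxrobust w' o' x' y' z' hxy' hxz' hyz' F hFmono

/-- **Question 7 for three relays with ONE `δ` of slack.**  For `o, x, y, z ≠ b`, `x, y, z` distinct, `A = {x, y, z}`:
if `μ(z↔b) ≤ μ(x↔b) + δ` and `μ(z↔b) ≤ μ(y↔b) + δ` with `δ ≥ 0`, then
`μ({z↔b} ∩ {o↔A}) ≤ μ({o↔b} ∩ {o↔A}) + δ` (the sum-robust `q7_three_slack` gives `+ 2δ`; `δ = 0` is `q7_three`).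
[cite: KozmaNitzan2024, Question 7 (p. 36), Conjectures 1–2 (p. 3)] -/
theorem q7_three_maxslack (w : Sym2 V → unitInterval) (o b x y z : V) (hob : o ≠ b) (hxb : x ≠ b) (hyb : y ≠ b)
    (hzb : z ≠ b) (hxy : x ≠ y) (hxz : x ≠ z) (hyz : y ≠ z) (δ : ℝ) (hδ : 0 ≤ δ)
    (hzx : (prodBernoulli w).real (openConn z b) ≤ (prodBernoulli w).real (openConn x b) + δ)
    (hzy : (prodBernoulli w).real (openConn z b) ≤ (prodBernoulli w).real (openConn y b) + δ) :
    (prodBernoulli w).real (openConn z b ∩ (openConn o x ∪ openConn o y ∪ openConn o z)) ≤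
      (prodBernoulli w).real (openConn o b ∩ (openConn o x ∪ openConn o y ∪ openConn o z)) + δ := by
  have key := q7_three_maxrobust w o b x y z hob hxb hyb hzb hxy hxz hyz
  have h1 : -δ ≤ min (min ((prodBernoulli w).real (openConn x b) - (prodBernoulli w).real (openConn z b))
      ((prodBernoulli w).real (openConn y b) - (prodBernoulli w).real (openConn z b))) 0 :=
    le_min (le_min (by linarith) (by linarith)) (by linarith)
  linarith

/-- **Max-robust Question 7, deficit-to-the-minimum form** (prim-lf-3's wording): for `o, x, y, z ≠ b`, `x, y, z` distinct,
`A = {x, y, z}` and ANY real `m ≤ μ(x↔b)`, `m ≤ μ(y↔b)` (e.g. `m = min_{a∈A} μ(a↔b)`):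
`μ({z↔b} ∩ {o↔A}) + m ≤ μ({o↔b} ∩ {o↔A}) + μ(z↔b)` whenever `m ≤ μ(z↔b)`; stated without that proviso as
`μ({z↔b} ∩ {o↔A}) − μ({o↔b} ∩ {o↔A}) ≤ max (μ(z↔b) − m) 0`. [cite: KozmaNitzan2024, Question 7 (p. 36)] -/
theorem q7_three_maxrobust_min (w : Sym2 V → unitInterval) (o b x y z : V) (hob : o ≠ b) (hxb : x ≠ b) (hyb : y ≠ b)
    (hzb : z ≠ b) (hxy : x ≠ y) (hxz : x ≠ z) (hyz : y ≠ z) (m : ℝ)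
    (hmx : m ≤ (prodBernoulli w).real (openConn x b)) (hmy : m ≤ (prodBernoulli w).real (openConn y b)) :
    (prodBernoulli w).real (openConn z b ∩ (openConn o x ∪ openConn o y ∪ openConn o z)) -
        (prodBernoulli w).real (openConn o b ∩ (openConn o x ∪ openConn o y ∪ openConn o z)) ≤
      max ((prodBernoulli w).real (openConn z b) - m) 0 := by
  have key := q7_three_maxrobust w o b x y z hob hxb hyb hzb hxy hxz hyz
  rcases le_or_gt ((prodBernoulli w).real (openConn z b) - m) 0 with h | h
  · rw [max_eq_right h]
    have h1 : 0 ≤ min (min ((prodBernoulli w).real (openConn x b) - (prodBernoulli w).real (openConn z b))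
        ((prodBernoulli w).real (openConn y b) - (prodBernoulli w).real (openConn z b))) 0 :=
      le_min (le_min (by linarith) (by linarith)) le_rfl
    linarith
  · rw [max_eq_left h.le]
    have h1 : m - (prodBernoulli w).real (openConn z b) ≤
        min (min ((prodBernoulli w).real (openConn x b) - (prodBernoulli w).real (openConn z b))
          ((prodBernoulli w).real (openConn y b) - (prodBernoulli w).real (openConn z b))) 0 :=
      le_min (le_min (by linarith) (by linarith)) (by linarith)
    linarith

/-- **`Finset` form of the max-robust inequality** (the shape of `q7_of_psi_robust`, `A = {x, y, z}`).
[cite: KozmaNitzan2024, Question 7 (p. 36)] -/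
theorem q7_three_maxrobust_finset (w : Sym2 V → unitInterval) (o b x y z : V) (hob : o ≠ b) (hxb : x ≠ b)
    (hyb : y ≠ b) (hzb : z ≠ b) (hxy : x ≠ y) (hxz : x ≠ z) (hyz : y ≠ z) :
    min (min ((prodBernoulli w).real (openConn x b) - (prodBernoulli w).real (openConn z b))
        ((prodBernoulli w).real (openConn y b) - (prodBernoulli w).real (openConn z b))) 0 ≤
      (prodBernoulli w).real (openConn o b ∩ ⋃ a ∈ ({x, y, z} : Finset V), (openConn o a : Set (BondConfig V))) -
        (prodBernoulli w).real
          (openConn z b ∩ ⋃ a ∈ ({x, y, z} : Finset V), (openConn o a : Set (BondConfig V))) := by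
  have hA : ∀ X : Set (BondConfig V), X ∩ (⋃ a ∈ ({x, y, z} : Finset V), (openConn o a : Set (BondConfig V))) =
      X ∩ (openConn o x ∪ openConn o y ∪ openConn o z) := by
    intro X; congr 1; ext ω; simp [or_assoc]
  rw [hA, hA]
  exact q7_three_maxrobust w o b x y z hob hxb hyb hzb hxy hxz hyz

end Q7Psi

end

end Summit.CriticalPhenomena.PercolationContinuityZ3.Theorems
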